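import Summits.QuantumFields.YangMills.Theorems.MirrorModularBoostsSoftKernelBoostCovarianceBumpChain
import Summits.QuantumFields.YangMills.Theorems.MirrorModularBoostsSoftKernelBoostCovarianceInsertionOps
import Summits.QuantumFields.YangMills.Theorems.MirrorModularBoostsSoftKernelBoostCovarianceAsmGeometryMargins
import Summits.QuantumFields.YangMills.Theorems.MirrorModularBoostsSoftKernelBoostCovarianceAsmConstantsAndBumps

/-!
# Bump chains with their insertion operators built in — stub (G)

Line `Sketch` of crux `MirrorModularBoosts.SoftKernelBoostCovariance` (stmt-QuantumFields-14999), piece (G) of the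
lead's assembly (T7).  Model-blind Osterwalder–Schrader bookkeeping over the `e₀`-reconstruction
`h : OSReconstructionNoE1 S₁.toLabelled` of a one-species Schwinger family `S₁` on `ℝ⁴`.

**Statement** (`stub_asmBumpChainOps`).  The landed chain theorem (T3b) `stub_bumpChain` / `chain_exists_bc`
(`…BumpChain.lean`) composed with the landed insertion operators (T1) `stub_insertionOps` (`…InsertionOps.lean`)
and the sandwich bound (a hypothesis, in per-degree vector form), so that the assembly never sees insertion
operators: for a radial-bump tensor `T` of degree `n` (ONE profile `φ` of radius `ρ` with `∫|φ(|·|²)| ≤ 1`, items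
`f0 j` centred at the planar origin, transverse profiles `hh j` with `‖hh j‖₁, ‖hh j‖_∞ ≤ A`, centres `c j`), a
reference point `q`, a pull-back `w ≥ 0`, ONE reserve `u` (`2ρ ≤ u ≤ 1`) and a height `R`: if for real `|θ| < ε`
the rotated first gap `R_θ(c₀ − q)` has time `≥ g₁` and the consecutive rotated gaps have times `≥ g₂`, with
`w + u + ρ ≤ g₁ e^{-R}` and `3u ≤ g₂ e^{-R}`, then the configuration `τ_{−(R_θ q + w e₀)} R_θ T` is time-ordered
and its field vectors are the real values of a family holomorphic on the rectangle `{|Re ζ| < ε, |Im ζ| < R}`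
bounded by `(max (C·1·(A+A)·(u^{-μ}+u^{-μ})) 0)ⁿ · ‖Ψ_1‖`.

**Proof.**
* The items at reserve `u` are `f j := τ_{(u+ρ)e₀} f0 j` (`translateMulti`, `item_apply_ops`); their planar
  profile `g p = φ((p₁ − (u+ρ))² + p₂²)` is non-zero only for `p₁ ∈ [u, u + 2ρ] ⊆ [u, 2u]` (`profile_slab_ops`),
  is integrable and has `∫‖g‖ = ∫‖φ(|·|²)‖ ≤ 1` (translation invariance of Lebesgue measure on `ℝ × ℝ`:
  `profile_integrable_ops`, `profile_integral_norm_ops`).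
* So the sandwich bound at `u = v` (with `Mg = 1`, `Mh = Mh' = A`) is exactly the hypothesis of (T1) in every
  degree `n − 1 − j`, with `K = C·1·(A+A)·(u^{-μ}+u^{-μ})`; (T1) gives `B j` with `‖B j‖ ≤ max K 0`.
* The tube hypotheses of (T3b) follow from the real gap hypotheses by the landed `tube_of_gap`
  (`…AsmGeometryMargins.lean`) with `(g₀, r) = (g₁, w + u + ρ)` and `(g₂, 2u + u)`.
* `isTimeOrdered_cfg_bc` gives the time-ordering, `chain_exists_bc` the family `V` bounded by
  `(∏ ‖B j‖)·‖Ψ_1‖ ≤ (max K 0)ⁿ·‖Ψ_1‖` (`Finset.prod_le_prod`, norms are nonnegative).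

References: J. Glimm, A. Jaffe, *Quantum Physics* (2nd ed. 1987), §19.5–19.7; K. Osterwalder, R. Schrader,
CMP 31 (1973) §4.1; CMP 42 (1975) §V.
-/

noncomputable section

namespace Summit.QuantumFields.YangMills.Theorems.SoftKernelBoostCovariance.Sketch

open scoped BigOperators InnerProductSpace SchwartzMap
open MeasureTheory
open Literature.MathematicalPhysics.QuantumLattice Literature.MathematicalPhysics.AQFT
  Literature.MathematicalPhysics.QuantumFieldTheory
open Summit.QuantumFields.YangMills.Theorems.NPointIsotropy.Negative (E4)

/-! ## The items at reserve `u` and their planar profile -/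

/-- **The item at reserve `u` pointwise**: the bump `f0` (centred at the planar origin) translated by `a e₀` is the
bump centred at the planar point `(a, 0)`. -/
theorem item_apply_ops (φ : ℝ → ℂ) (hh : ℝ × ℝ → ℂ) (f0 : 𝓢((Fin 1 → E4), ℂ)) (a : ℝ)
    (hf0 : ∀ x : Fin 1 → E4, f0 x = φ ((x 0 0) ^ 2 + (x 0 1) ^ 2) * hh (x 0 2, x 0 3)) (x : Fin 1 → E4) :
    translateMulti (a • EuclideanSpace.single 0 1) f0 x =
      φ ((x 0 0 - a) ^ 2 + (x 0 1) ^ 2) * hh (x 0 2, x 0 3) := by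
  rw [translateMulti_apply, hf0]
  simp

/-- **The planar profile of the item at reserve `u` lives in the time slab `[u, 2u]`**: `φ` vanishes beyond `ρ²`
and `2ρ ≤ u`. -/
theorem profile_slab_ops {φ : ℝ → ℂ} {u ρ : ℝ} (hρ : 0 < ρ) (h2ρ : 2 * ρ ≤ u)
    (hφ : ∀ s : ℝ, ρ ^ 2 < s → φ s = 0) (p : ℝ × ℝ) (hp : φ ((p.1 - (u + ρ)) ^ 2 + p.2 ^ 2) ≠ 0) :
    u ≤ p.1 ∧ p.1 ≤ 2 * u := by
  have h1 : (p.1 - (u + ρ)) ^ 2 + p.2 ^ 2 ≤ ρ ^ 2 := not_lt.1 fun h' => hp (hφ _ h')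
  have h2 : |p.1 - (u + ρ)| ≤ ρ := abs_le_of_sq_le_sq (by nlinarith [sq_nonneg p.2]) hρ.le
  obtain ⟨h3, h4⟩ := abs_le.1 h2
  constructor <;> linarith

/-- The planar profile of the item is integrable (translation invariance of Lebesgue measure on `ℝ × ℝ`). -/
theorem profile_integrable_ops {φ : ℝ → ℂ} (a : ℝ)
    (hφi : Integrable (fun p : ℝ × ℝ => φ (p.1 ^ 2 + p.2 ^ 2))) :
    Integrable (fun p : ℝ × ℝ => φ ((p.1 - a) ^ 2 + p.2 ^ 2)) := by
  have h := hφi.comp_sub_right (a, 0)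
  simpa using h

/-- The `L¹` norm of the planar profile of the item is that of the centred profile (translation invariance of
Lebesgue measure on `ℝ × ℝ`). -/
theorem profile_integral_norm_ops {φ : ℝ → ℂ} (a : ℝ) :
    (∫ p : ℝ × ℝ, ‖φ ((p.1 - a) ^ 2 + p.2 ^ 2)‖) = ∫ p : ℝ × ℝ, ‖φ (p.1 ^ 2 + p.2 ^ 2)‖ := by
  have h := integral_sub_right_eq_self (μ := (volume : Measure (ℝ × ℝ)))
    (fun p : ℝ × ℝ => ‖φ (p.1 ^ 2 + p.2 ^ 2)‖) (a, 0)
  simpa using h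

/-- A product of `n` nonnegative reals each `≤ M` is `≤ Mⁿ`. -/
theorem prod_norm_le_pow_ops {H : Type*} [SeminormedAddCommGroup H] {n : ℕ} (B : Fin n → H) (M : ℝ)
    (hB : ∀ j, ‖B j‖ ≤ M) : (∏ j, ‖B j‖) ≤ M ^ n := by
  calc (∏ j, ‖B j‖) ≤ ∏ _j : Fin n, M := Finset.prod_le_prod (fun j _ => norm_nonneg _) fun j _ => hB j
    _ = M ^ n := Fin.prod_const n M

/-! ## The stub -/

variable {S₁ : SchwingerFamily E4}

/-- **The tube hypotheses of the chain from the real gap hypotheses** (`tube_of_gap` with `(g₀, r) = (g₁, w+u+ρ)`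
for the first gap and `(g₂, 2u+u)` for the consecutive gaps; `2u + u = 3u`). -/
theorem tubes_of_gaps_ops {n : ℕ} {u ρ w ε R g₁ g₂ : ℝ} (c : Fin n → ℝ × ℝ) (q : ℝ × ℝ)
    (hg₁ : 0 < g₁) (hg₂ : 0 < g₂) (hr₁ : w + u + ρ ≤ g₁ * Real.exp (-R)) (hr₂ : 3 * u ≤ g₂ * Real.exp (-R))
    (hgap : ∀ θ : ℝ, |θ| < ε →
      (∀ j : Fin n, (j : ℕ) = 0 → g₁ ≤ Real.cos θ * ((c j).1 - q.1) + Real.sin θ * ((c j).2 - q.2)) ∧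
      (∀ i j : Fin n, (j : ℕ) = i + 1 →
        g₂ ≤ Real.cos θ * ((c j).1 - (c i).1) + Real.sin θ * ((c j).2 - (c i).2))) :
    (∀ j : Fin n, (j : ℕ) = 0 → ∀ ζ : ℂ, |ζ.re| < ε → |ζ.im| < R →
      |(-Complex.sin ζ * ((c j).1 - q.1) + Complex.cos ζ * ((c j).2 - q.2)).im| <
        (Complex.cos ζ * ((c j).1 - q.1) + Complex.sin ζ * ((c j).2 - q.2)).re - (w + u + ρ)) ∧
    (∀ i j : Fin n, (j : ℕ) = i + 1 → ∀ ζ : ℂ, |ζ.re| < ε → |ζ.im| < R →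
      |(-Complex.sin ζ * ((c j).1 - (c i).1) + Complex.cos ζ * ((c j).2 - (c i).2)).im| <
        (Complex.cos ζ * ((c j).1 - (c i).1) + Complex.sin ζ * ((c j).2 - (c i).2)).re - (2 * u + u)) := by
  refine ⟨fun j hj ζ h1 h2 => ?_, fun i j hij ζ h1 h2 => ?_⟩
  · have h3 := tube_of_gap hg₁ hr₁ (fun x hx => (hgap x hx).1 j hj) h1 h2
    exact_mod_cast h3
  · have hr' : 2 * u + u ≤ g₂ * Real.exp (-R) := by linarith
    have h3 := tube_of_gap hg₂ hr' (fun x hx => (hgap x hx).2 i j hij) h1 h2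
    exact_mod_cast h3

/-- **Stub (G) — BUMP CHAINS WITH THEIR INSERTION OPERATORS BUILT IN (model-blind OS bookkeeping).**  The landed
chain theorem (T3b) composed with the landed insertion operators (T1) and the sandwich bound (hypothesis): for a
radial-bump tensor `T` of degree `n` (ONE profile `φ` of radius `ρ` with `∫|φ(|·|²)| ≤ 1`, items `f0 j` centred at
the planar origin, transverse profiles `hh j` with `‖hh j‖₁, ‖hh j‖_∞ ≤ A`, centres `c j`), a reference point `q`, a
pull-back `w ≥ 0`, ONE reserve `u` (`2ρ ≤ u ≤ 1`) and a height `R`: if for real `|θ| < ε` the rotated first gap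
`R_θ(c₀ − q)` has time `≥ g₁` and the consecutive rotated gaps have times `≥ g₂`, with `w + u + ρ ≤ g₁ e^{-R}` and
`3u ≤ g₂ e^{-R}`, then the configuration `τ_{−(R_θ q + w e₀)} R_θ T` is time-ordered and its field vectors are the
real values of a family holomorphic on the rectangle `{|Re ζ| < ε, |Im ζ| < R}` bounded by
`(max (C·1·(A+A)·(u^{-μ}+u^{-μ})) 0)ⁿ · ‖Ψ_1‖`.  Proof: items `f j := τ_{(u+ρ)e₀} f0 j` (`item_apply_ops`); their
planar profile lives in the slab `[u, 2u]` with `L¹` norm `≤ 1` (`profile_slab_ops`, `profile_integrable_ops`,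
`profile_integral_norm_ops`), so the sandwich bound at `u = v` is the hypothesis of (T1) `stub_insertionOps` in
every degree `n − 1 − j`, giving `B j` with `‖B j‖ ≤ max K 0`; the tube hypotheses come from `tube_of_gap`
(`tubes_of_gaps_ops`); then `isTimeOrdered_cfg_bc` and `chain_exists_bc`, and `∏ ‖B j‖ ≤ (max K 0)ⁿ`. -/
theorem stub_asmBumpChainOps :
    open Literature.MathematicalPhysics.QuantumLattice Literature.MathematicalPhysics.AQFT
      Literature.MathematicalPhysics.QuantumFieldTheory
      Summit.QuantumFields.YangMills.Theorems.CurvatureBoostCovariance.Negative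
      Summit.QuantumFields.YangMills.Theorems.NPointIsotropy.Negative in
    ∀ (S₁ : SchwingerFamily E4) (h : OSReconstructionNoE1 S₁.toLabelled)
      (N : ℂ × ℂ → (h.Hilbert →L[ℂ] h.Hilbert)),
      (∀ p : ℂ × ℂ, |p.2.im| < p.1.re → ‖N p‖ ≤ 1) →
      (∀ ψ ψ' : h.Hilbert, DifferentiableOn ℂ (fun p : ℂ × ℂ => ⟪ψ, N p ψ'⟫_ℂ) {p : ℂ × ℂ | |p.2.im| < p.1.re}) →
      (∀ (t b : ℝ), 0 < t → ∀ ψ : h.Hilbert,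
        N ((t : ℂ), (b : ℂ)) ψ = h.transfer t (h.translate (b • EuclideanSpace.single 1 1) ψ)) →
      ∀ (μ C : ℝ),
        (∀ (u v : ℝ), 0 < u → 0 < v → u ≤ 1 → v ≤ 1 →
           ∀ (f₁ : SchwartzMap (Fin 1 → E4) ℂ) (g hh : ℝ × ℝ → ℂ) (Mg Mh Mh' : ℝ),
             (∀ x : Fin 1 → E4, f₁ x = g (x 0 0, x 0 1) * hh (x 0 2, x 0 3)) →
             (∀ p : ℝ × ℝ, g p ≠ 0 → u ≤ p.1 ∧ p.1 ≤ 2 * u) →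
             MeasureTheory.Integrable g → (∫ p, ‖g p‖) ≤ Mg →
             MeasureTheory.Integrable hh → (∫ p, ‖hh p‖) ≤ Mh → (∀ p, ‖hh p‖ ≤ Mh') →
           ∀ (n : ℕ) (W : SchwartzMap (Fin n → E4) ℂ) (hW : IsTimeOrdered W)
             (hFW : IsTimeOrdered
               (SchwartzMap.appendTensor f₁ (translateMulti ((2 * u + v) • EuclideanSpace.single 0 1) W))),
             ‖h.fieldVec (1 + n) (fun _ => ())
                 (SchwartzMap.appendTensor f₁ (translateMulti ((2 * u + v) • EuclideanSpace.single 0 1) W)) hFW‖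
               ≤ C * Mg * (Mh + Mh') * (u ^ (-μ) + v ^ (-μ)) * ‖h.fieldVec n (fun _ => ()) W hW‖) →
      ∀ (n : ℕ) (u ρ w ε R g₁ g₂ A : ℝ) (φ : ℝ → ℂ) (hh : Fin n → ℝ × ℝ → ℂ)
        (f0 : Fin n → SchwartzMap (Fin 1 → E4) ℂ) (c : Fin n → ℝ × ℝ) (q : ℝ × ℝ) (T : SchwartzMap (Fin n → E4) ℂ),
        0 < ρ → 2 * ρ ≤ u → u ≤ 1 → 0 ≤ w → 0 < ε → 0 < R → 0 < g₁ → 0 < g₂ →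
        w + u + ρ ≤ g₁ * Real.exp (-R) → 3 * u ≤ g₂ * Real.exp (-R) →
        (∀ s : ℝ, ρ ^ 2 < s → φ s = 0) →
        MeasureTheory.Integrable (fun p : ℝ × ℝ => φ (p.1 ^ 2 + p.2 ^ 2)) →
        (∫ p : ℝ × ℝ, ‖φ (p.1 ^ 2 + p.2 ^ 2)‖) ≤ 1 →
        (∀ (j : Fin n) (x : Fin 1 → E4), f0 j x = φ ((x 0 0) ^ 2 + (x 0 1) ^ 2) * hh j (x 0 2, x 0 3)) →
        (∀ x : Fin n → E4, T x = ∏ j, φ ((x j 0 - (c j).1) ^ 2 + (x j 1 - (c j).2) ^ 2) * hh j (x j 2, x j 3)) →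
        (∀ j : Fin n, MeasureTheory.Integrable (hh j) ∧ (∫ p : ℝ × ℝ, ‖hh j p‖) ≤ A ∧ ∀ p : ℝ × ℝ, ‖hh j p‖ ≤ A) →
        (∀ θ : ℝ, |θ| < ε →
          (∀ j : Fin n, (j : ℕ) = 0 →
            g₁ ≤ Real.cos θ * ((c j).1 - q.1) + Real.sin θ * ((c j).2 - q.2)) ∧
          (∀ i j : Fin n, (j : ℕ) = i + 1 →
            g₂ ≤ Real.cos θ * ((c j).1 - (c i).1) + Real.sin θ * ((c j).2 - (c i).2))) →
        (∀ θ : ℝ, |θ| < ε → IsTimeOrdered (translateMulti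
              (-((Real.cos θ * q.1 + Real.sin θ * q.2 + w) • EuclideanSpace.single 0 1 +
                (-Real.sin θ * q.1 + Real.cos θ * q.2) • EuclideanSpace.single 1 1))
              (linActMulti (planeRot (0 : Fin 3) θ) T))) ∧
        ∃ V : ℂ → h.Hilbert,
          DifferentiableOn ℂ V {ζ : ℂ | |ζ.re| < ε ∧ |ζ.im| < R} ∧
          (∀ ζ : ℂ, |ζ.re| < ε → |ζ.im| < R →
            ‖V ζ‖ ≤ (max (C * 1 * (A + A) * (u ^ (-μ) + u ^ (-μ))) 0) ^ n *
              ‖h.fieldVec 0 (fun _ => ()) (SchwartzMap.constOfSubsingleton 1)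
                OSReconstructionNoE1.isTimeOrdered_constOfSubsingleton‖) ∧
          (∀ θ : ℝ, |θ| < ε → ∀ hθ : IsTimeOrdered (translateMulti
                  (-((Real.cos θ * q.1 + Real.sin θ * q.2 + w) • EuclideanSpace.single 0 1 +
                    (-Real.sin θ * q.1 + Real.cos θ * q.2) • EuclideanSpace.single 1 1))
                  (linActMulti (planeRot (0 : Fin 3) θ) T)),
            V θ = h.fieldVec n (fun _ => ()) (translateMulti
                  (-((Real.cos θ * q.1 + Real.sin θ * q.2 + w) • EuclideanSpace.single 0 1 +
                    (-Real.sin θ * q.1 + Real.cos θ * q.2) • EuclideanSpace.single 1 1))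
                  (linActMulti (planeRot (0 : Fin 3) θ) T)) hθ) := by
  intro S₁ h N hN1 hN2 hN3 μ C hSand n u ρ w ε R g₁ g₂ A φ hh f0 c q T hρ h2ρ hu1 hw _hε hR hg₁ hg₂ hr₁ hr₂ hφ hφi
    hφ1 hf0 hT hhh hgap
  have hu : 0 < u := by linarith
  obtain ⟨ht0, htS⟩ := tubes_of_gaps_ops (u := u) (ρ := ρ) (w := w) (R := R) c q hg₁ hg₂ hr₁ hr₂ hgap
  refine ⟨fun θ hθ => isTimeOrdered_cfg_bc φ hh c q T hu hρ h2ρ hR hφ hT ht0 htS hθ, ?_⟩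
  -- the items at reserve `u`
  have hf : ∀ (j : Fin n) (x : Fin 1 → E4), translateMulti ((u + ρ) • EuclideanSpace.single 0 1) (f0 j) x =
      φ ((x 0 0 - (u + ρ)) ^ 2 + (x 0 1) ^ 2) * hh j (x 0 2, x 0 3) :=
    fun j x => item_apply_ops φ (hh j) (f0 j) (u + ρ) (hf0 j) x
  -- the insertion operators, degree by degree, from (T1) and the sandwich bound at `u = v`
  have hBex : ∀ j : Fin n, ∃ B : h.Hilbert →L[ℂ] h.Hilbert,
      ‖B‖ ≤ max (C * 1 * (A + A) * (u ^ (-μ) + u ^ (-μ))) 0 ∧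
      ∀ (W : 𝓢((Fin (n - 1 - j) → E4), ℂ)) (hW : IsTimeOrdered W)
        (hFW : IsTimeOrdered (SchwartzMap.appendTensor (translateMulti ((u + ρ) • EuclideanSpace.single 0 1) (f0 j))
          (translateMulti ((2 * u + u) • EuclideanSpace.single 0 1) W))),
        B (h.fieldVec (n - 1 - j) (fun _ => ()) W hW) =
          h.fieldVec (1 + (n - 1 - j)) (fun _ => ())
            (SchwartzMap.appendTensor (translateMulti ((u + ρ) • EuclideanSpace.single 0 1) (f0 j))
              (translateMulti ((2 * u + u) • EuclideanSpace.single 0 1) W)) hFW := fun j =>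
    stub_insertionOps S₁ h (n - 1 - j) (translateMulti ((u + ρ) • EuclideanSpace.single 0 1) (f0 j))
      ((2 * u + u) • EuclideanSpace.single 0 1) (C * 1 * (A + A) * (u ^ (-μ) + u ^ (-μ))) fun W hW hFW =>
      hSand u u hu hu hu1 hu1 (translateMulti ((u + ρ) • EuclideanSpace.single 0 1) (f0 j))
        (fun p => φ ((p.1 - (u + ρ)) ^ 2 + p.2 ^ 2)) (hh j) 1 A A (hf j) (profile_slab_ops hρ h2ρ hφ)
        (profile_integrable_ops (u + ρ) hφi) ((profile_integral_norm_ops (u + ρ)).trans_le hφ1) (hhh j).1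
        (hhh j).2.1 (hhh j).2.2 (n - 1 - j) W hW hFW
  choose B hBn hBe using hBex
  obtain ⟨V, hVd, hVb, hVr⟩ := chain_exists_bc h N hN1 hN2 hN3 φ hu hu hρ h2ρ hR hφ n hh
    (fun j => translateMulti ((u + ρ) • EuclideanSpace.single 0 1) (f0 j)) B c q w T hw hf hT
    (fun j m hm W hW hFW => by subst hm; exact hBe j W hW hFW) ht0 htS
  exact ⟨V, hVd, fun ζ h1 h2 => (hVb ζ h1 h2).trans
    (mul_le_mul_of_nonneg_right (prod_norm_le_pow_ops B _ hBn) (norm_nonneg _)), hVr⟩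

end Summit.QuantumFields.YangMills.Theorems.SoftKernelBoostCovariance.Sketch

end
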